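import Summits.BirchSwinnertonDyer.Rank1Residual.Additive.RamifiedSevenGenusKummerLayerTransport
import HarnessLib

/-!
# `𝒞₇` genus road (crux `EllipticUnitValueSevenOfGZK`, K7r), row K2C-12 = (B2′) KUMMER NON-VANISHING, File A2b:
# THE LAYER INDEX — the `6`-torsion of `Uₙ` on `μ_{7^{n+1}}` (hK), Hensel `ω(a) ≡ a`, (U*) `Uₙ ⊓ H₀ ≤ Hₙ`,
# exponent `6` of `Γ_K/H₀`, (A2) `7 ∤ [Γ_K : H₀]`, `Uₙ ⊔ H₀ = Γ_K`

Cell bsd-cm, seat bsd-cm-k-ty1 g32; pen START packet `bsd-cm-plan/g38/START-kty1-g32.md` §2 ((A2)-lemma, DERIVE — do NOT display);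
ruling D1082.  Sequel of `RamifiedSevenGenusKummerLayerTransport.lean` (same setting: `e : K̄ →+* ℚ̄` arbitrary, `c : Γ_K →* Γ_ℚ` any
transport of `e`, `Hₙ = layerFixing F e n`, `Uₙ = (K_cyc.restrictOfFinrankEqTwo _ Kcm h2).layerSubgroup n`, `K_cyc` cyclotomic (A0)).
* §3 (A0): `modEq_of_pow_eq_pow`, `exists_modEq_pow_six_of_mem_layerSubgroup` (`σ ∈ Uₙ` acts on the `7^{n+1}`-th roots of unity of
  `K̄` by an `a` with `a⁶ ≡ 1 (7^{n+1})` — Washington §13.1 `Gal(ℚ(ζ_{p^{n+1}})/ℚₙ) = Δ`, read in `K̄` through `absGaloisRestrict`),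
  `modEq_one_of_pow_six` (`a ≡ 1 (7)`, `a⁶ ≡ 1 (7^{n+1})` ⇒ `a ≡ 1 (7^{n+1})`), `natCast_sub_omega_mem_span_of_pow_six` (Hensel in
  `ℤ₇`: `a ≡ ω(a) (7^{n+1})`), ★ `smul_eq_pow_of_cyclotomicCharacter_eq_omega'` (a torsion element `υ` with `χ₇(υ) = ω(a)` acts on
  `μ_{7^{n+1}}` by `a` when `a⁶ ≡ 1 (7^{n+1})` — E1's lift WITHOUT the `γ₀`-factor, for exponents of elements of `Uₙ`).
* §4 `pow_smul_eq_pow_pow`; (U*) ★ `inf_layerFixing_zero_le` (`Uₙ ⊓ H₀ ≤ Hₙ`); `pow_six_mem_layerFixing_zero` (`σ⁶ ∈ H₀`);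
  ★ (A2) `not_seven_dvd_index_layerFixing_zero` (Cauchy); `layerSubgroup_sup_layerFixing_zero` (`Uₙ ⊔ H₀ = ⊤`: the index divides
  `7ⁿ` and `[Γ_K:H₀]`); `exists_mem_layerSubgroup_inv_mul_mem` (every `H₀`-coset meets `Uₙ`).  With (U*) these give the bijection
  `Uₙ/Hₙ ≃ Γ_K/H₀` used by the twisted norms of (B2′) (one rep system for all levels), and `[Uₙ : Hₙ] = [Γ_K : H₀] ≢ 0 (7)`.
HONEST LABEL: Galois/number bookkeeping; theorems only; no definition, no named fact, no instance, no sorry; nothing closes;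
(B2′) NOT proved here; stmt-BirchSwinnertonDyer-19945 OPEN; BSD claimed for no curve.

## References
* L. C. Washington, *Introduction to Cyclotomic Fields* (1997), Thm. 2.5, §13.1. [Washington1997]
* S. Lang, *Cyclotomic Fields I–II* (1990), Ch. 10 §1 (PDF p. 167, ω and ⟨a⟩). [Lang1990]
* T. Tsuji, J. Number Theory 78 (1999), §3 (p. 6). [Tsuji1999]
* K. Kato, Astérisque 295 (2004), §15.5 (p. 253). [Kato2004Asterisque]
-/

noncomputable section

open scoped NumberField
open Field Polynomial
open Literature.NumberTheory.IwasawaTheory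
open Literature.NumberTheory.GaloisRepresentations Literature.NumberTheory.GaloisRepresentations.LocalWeilDatum
open Literature.NumberTheory.EllipticCurves

namespace Summit.BirchSwinnertonDyer.Rank1Residual.Additive.GenusSeven

namespace GenusFrame

variable (F : GenusFrame) {Kcm : Type} [Field Kcm] [NumberField Kcm]
  (e : AlgebraicClosure Kcm →+* AlgebraicClosure ℚ)

/-! ## §3 (A0): `σ ∈ Uₙ` acts on `μ_{7^{n+1}}(K̄)` through a `6`-torsion exponent; Hensel -/

section Layer

variable (h2 : Module.finrank ℚ Kcm = 2) (K : ZpExtension ℚ 7)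

/-- Exponents of a primitive `k`-th root of unity are determined modulo `k`. [cite: Washington1997, Thm. 2.5] -/
theorem modEq_of_pow_eq_pow {M : Type*} [CommMonoid M] {ζ : M} {k : ℕ} [NeZero k] (hζ : IsPrimitiveRoot ζ k) {a b : ℕ}
    (h : ζ ^ a = ζ ^ b) : a ≡ b [MOD k] := by
  rw [pow_eq_pow_mod a hζ.pow_eq_one, pow_eq_pow_mod b hζ.pow_eq_one] at h
  exact hζ.pow_inj (Nat.mod_lt _ (NeZero.pos k)) (Nat.mod_lt _ (NeZero.pos k)) h

/-- **`σ ∈ Uₙ = Gal(K̄/Kℚₙ)` acts on the `7^{n+1}`-th roots of unity of `K̄` by an exponent `a` with `a⁶ ≡ 1 (7^{n+1})`**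
(`res σ ∈ Gal(ℚ̄/ℚₙ)` for the cyclotomic `K_cyc`, `ZpExtension.IsCyclotomic.modNCyclotomicCharacter_pow_eq_one_of_mem_layerSubgroup`,
read in `K̄` through the chosen `ι : ℚ̄ ≅ K̄` of `absGaloisRestrict`). [cite: Washington1997, §13.1 («Gal(ℚ(ζ_{p^{n+1}})/ℚ_n) = Δ»)] -/
theorem exists_modEq_pow_six_of_mem_layerSubgroup (hK : K.IsCyclotomic) (n : ℕ) {σ : absoluteGaloisGroup Kcm}
    (hσ : σ ∈ (K.restrictOfFinrankEqTwo (by decide) Kcm h2).layerSubgroup n)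
    {ζ' : AlgebraicClosure Kcm} (hζ' : IsPrimitiveRoot ζ' (7 ^ (n + 1))) {a : ℕ} (ha : σ • ζ' = ζ' ^ a) :
    a ^ 6 ≡ 1 [MOD 7 ^ (n + 1)] := by
  haveI : Fact (Nat.Prime 7) := ⟨Nat.prime_seven⟩
  haveI : NeZero (7 ^ (n + 1)) := ⟨pow_ne_zero _ (by norm_num)⟩
  -- `res σ ∈ K_cyc.layerSubgroup n`
  have hres : absGaloisRestrict ℚ Kcm σ ∈ K.layerSubgroup n := by
    rw [ZpExtension.mem_layerSubgroup] at hσ ⊢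
    rwa [ZpExtension.restrictOfFinrankEqTwo_apply] at hσ
  have h6 := hK.modNCyclotomicCharacter_pow_eq_one_of_mem_layerSubgroup (by decide) n rfl hres
  set v : ℕ := ((modNCyclotomicCharacter ℚ (7 ^ (n + 1)) (absGaloisRestrict ℚ Kcm σ) : (ZMod (7 ^ (n + 1)))ˣ) :
    ZMod (7 ^ (n + 1))).val with hvdef
  -- `σ` acts on `ζ′ = ι t` as `res σ` acts on `t`, i.e. by `v`
  obtain ⟨t, rfl⟩ := (Literature.NumberTheory.GaloisRepresentations.absClosureEmbedding_bijective ℚ Kcm).2 ζ'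
  have ht : t ^ 7 ^ (n + 1) = 1 := by
    apply (Literature.NumberTheory.GaloisRepresentations.absClosureEmbedding_bijective ℚ Kcm).1
    rw [map_pow, hζ'.pow_eq_one, map_one]
  have hspec := modNCyclotomicCharacter_spec ℚ (7 ^ (n + 1)) (absGaloisRestrict ℚ Kcm σ) t ht
  have hv : absClosureEmbedding ℚ Kcm t ^ a = absClosureEmbedding ℚ Kcm t ^ v := by
    rw [← ha, hvdef, ← map_pow, ← hspec, absGaloisRestrict_apply_smul]
  have hav : a ≡ v [MOD 7 ^ (n + 1)] := modEq_of_pow_eq_pow hζ' hv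
  -- `v⁶ ≡ 1`
  have hv6 : v ^ 6 ≡ 1 [MOD 7 ^ (n + 1)] := by
    have h1 : (((modNCyclotomicCharacter ℚ (7 ^ (n + 1)) (absGaloisRestrict ℚ Kcm σ) : (ZMod (7 ^ (n + 1)))ˣ) :
        ZMod (7 ^ (n + 1)))) ^ 6 = 1 := by
      have := congrArg Units.val h6
      simpa using this
    rw [← ZMod.natCast_zmod_val (((modNCyclotomicCharacter ℚ (7 ^ (n + 1)) (absGaloisRestrict ℚ Kcm σ) :
      (ZMod (7 ^ (n + 1)))ˣ) : ZMod (7 ^ (n + 1)))), ← hvdef] at h1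
    rw [← ZMod.natCast_eq_natCast_iff, Nat.cast_pow, Nat.cast_one]
    exact h1
  exact (hav.pow 6).trans hv6

/-- **Hensel for the `6`-torsion**: if `a ≡ 1 (7)` and `a⁶ ≡ 1 (7^{n+1})` then `a ≡ 1 (7^{n+1})` (`a^{7ⁿ} = a` as `7ⁿ ≡ 1 (6)`, and
`a ≡ 1 (7) ⇒ a^{7ⁿ} ≡ 1 (7^{n+1})`, Mathlib `dvd_sub_pow_of_dvd_sub`). [cite: Lang1990, Ch. 10 §1 (PDF p. 167)] -/
theorem modEq_one_of_pow_six {n a : ℕ} (h1 : a ≡ 1 [MOD 7]) (h6 : a ^ 6 ≡ 1 [MOD 7 ^ (n + 1)]) :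
    a ≡ 1 [MOD 7 ^ (n + 1)] := by
  have hmod : ∀ m : ℕ, 7 ^ m % 6 = 1 := by
    intro m
    induction m with
    | zero => rfl
    | succ k ih => rw [pow_succ, Nat.mul_mod, ih]
  -- in `ZMod (7^{n+1})`
  have h6' : (a : ZMod (7 ^ (n + 1))) ^ 6 = 1 := by
    have := (ZMod.natCast_eq_natCast_iff _ _ _).mpr h6
    push_cast at this
    exact this
  have hdecomp : 7 ^ n = 6 * (7 ^ n / 6) + 1 := by
    have := Nat.div_add_mod (7 ^ n) 6
    rw [hmod n] at this
    omega
  have ha7 : (a : ZMod (7 ^ (n + 1))) ^ 7 ^ n = a := by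
    rw [hdecomp, pow_add (a : ZMod (7 ^ (n + 1))), pow_one, pow_mul, h6', one_pow, one_mul]
  -- `7 ∣ a - 1`: `a = 7 (a / 7) + 1`
  have h1' : a % 7 = 1 := h1
  have hdiv : ((7 : ℕ) : ZMod (7 ^ (n + 1))) ∣ (a : ZMod (7 ^ (n + 1))) - 1 := by
    refine ⟨((a / 7 : ℕ) : ZMod (7 ^ (n + 1))), ?_⟩
    have := Nat.div_add_mod a 7
    rw [h1'] at this
    have hcast : (a : ZMod (7 ^ (n + 1))) = ((7 * (a / 7) + 1 : ℕ) : ZMod (7 ^ (n + 1))) := by rw [this]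
    rw [hcast]; push_cast; ring
  -- `7^{n+1} ∣ a^{7ⁿ} - 1 = a - 1`, and `7^{n+1} = 0` in `ZMod (7^{n+1})`
  have hdvd := dvd_sub_pow_of_dvd_sub hdiv n
  rw [one_pow, ha7, ← Nat.cast_pow, ZMod.natCast_self, zero_dvd_iff, sub_eq_zero] at hdvd
  exact (ZMod.natCast_eq_natCast_iff _ _ _).mp (by rw [hdvd, Nat.cast_one])

/-- **Hensel in `ℤ₇`**: for `a` prime to `7` with `a⁶ ≡ 1 (7^{n+1})`, the Teichmüller value satisfies `ω(a) ≡ a (mod 7^{n+1})`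
(`ω(a) ≡ a (7)`, `ω(a)⁶ = 1`, and `x ≡ y (7) ⇒ x^{7ⁿ} ≡ y^{7ⁿ} (7^{n+1})`). [cite: Lang1990, Ch. 10 §1 (PDF p. 167, «a = ω(a)⟨a⟩»)] -/
theorem natCast_sub_omega_mem_span_of_pow_six {n a : ℕ} (ha7 : a.Coprime 7) (h6 : a ^ 6 ≡ 1 [MOD 7 ^ (n + 1)]) :
    (a : ℤ_[7]) - F.ω (a : ZMod 7) ∈ Ideal.span {((7 : ℕ) : ℤ_[7]) ^ (n + 1)} := by
  haveI : Fact (Nat.Prime 7) := ⟨Nat.prime_seven⟩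
  set w : ℤ_[7] := F.ω (a : ZMod 7) with hw
  have hmod : ∀ m : ℕ, 7 ^ m % 6 = 1 := by
    intro m
    induction m with
    | zero => rfl
    | succ k ih => rw [pow_succ, Nat.mul_mod, ih]
  -- (i) `7 ∣ a - w` (Teichmüller: `ω(a) ≡ a (7)`)
  have h7 : ((7 : ℕ) : ℤ_[7]) ∣ (a : ℤ_[7]) - w := by
    have hu : PadicInt.toZMod w = (a : ZMod 7) := by
      rw [hw, ← ZMod.coe_unitOfCoprime a ha7]
      exact F.ω_teichmuller (ZMod.unitOfCoprime a ha7)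
    have hker : (a : ℤ_[7]) - w ∈ RingHom.ker (PadicInt.toZMod : ℤ_[7] →+* ZMod 7) := by
      rw [RingHom.mem_ker, map_sub, hu, map_natCast, sub_self]
    rw [PadicInt.ker_toZMod, PadicInt.maximalIdeal_eq_span_p, Ideal.mem_span_singleton] at hker
    exact_mod_cast hker
  -- (ii) `7^{n+1} ∣ a^{7ⁿ} - w^{7ⁿ}`
  have hii := dvd_sub_pow_of_dvd_sub h7 n
  -- (iii) `w^{7ⁿ} = w` (`w⁶ = 1`)
  have hw6 : w ^ 6 = 1 := by
    rw [hw, ← ZMod.coe_unitOfCoprime a ha7, ← MulChar.coe_toUnitHom, ← Units.val_pow_eq_pow_val, ← map_pow,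
      show (6 : ℕ) = Nat.totient 7 by decide, ZMod.pow_totient, map_one, Units.val_one]
  have hw7 : w ^ 7 ^ n = w := by
    have hdecomp : 7 ^ n = 6 * (7 ^ n / 6) + 1 := by
      have := Nat.div_add_mod (7 ^ n) 6
      rw [hmod n] at this
      omega
    rw [hdecomp, pow_add w, pow_one, pow_mul, hw6, one_pow, one_mul]
  -- (iv) `7^{n+1} ∣ a^{7ⁿ} - a` (`a⁶ ≡ 1`)
  have hiv : ((7 : ℕ) : ℤ_[7]) ^ (n + 1) ∣ (a : ℤ_[7]) ^ 7 ^ n - a := by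
    have h6'' : ((7 : ℕ) : ℤ_[7]) ^ (n + 1) ∣ (a : ℤ_[7]) ^ 6 - 1 := by
      rw [← Ideal.mem_span_singleton, ← PadicInt.ker_toZModPow, RingHom.mem_ker, map_sub, map_pow, map_natCast, map_one,
        sub_eq_zero]
      have := (ZMod.natCast_eq_natCast_iff _ _ _).mpr h6
      push_cast at this
      exact this
    have hq : (a : ℤ_[7]) ^ 6 - 1 ∣ ((a : ℤ_[7]) ^ 6) ^ (7 ^ n / 6) - 1 := by
      simpa using sub_dvd_pow_sub_pow ((a : ℤ_[7]) ^ 6) 1 (7 ^ n / 6)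
    have hdecomp : 7 ^ n = 6 * (7 ^ n / 6) + 1 := by
      have := Nat.div_add_mod (7 ^ n) 6
      rw [hmod n] at this
      omega
    have h3 : (a : ℤ_[7]) ^ 7 ^ n - a = a * (((a : ℤ_[7]) ^ 6) ^ (7 ^ n / 6) - 1) := by
      conv_lhs => rw [hdecomp]
      ring
    rw [h3]
    exact Dvd.dvd.mul_left (h6''.trans hq) _
  -- combine
  rw [Ideal.mem_span_singleton]
  have : (a : ℤ_[7]) - w = -((a : ℤ_[7]) ^ 7 ^ n - a) + ((a : ℤ_[7]) ^ 7 ^ n - w ^ 7 ^ n) := by rw [hw7]; ring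
  rw [this]
  push_cast at hii hiv
  exact dvd_add (dvd_neg.mpr hiv) hii

/-- ★ **A torsion element `υ` with `χ₇(υ) = ω(a)` acts on `μ_{7^{n+1}}` as the `a`-th power whenever `a⁶ ≡ 1 (7^{n+1})`**
(`χ₇(υ) mod 7^{n+1} = ω(a) mod 7^{n+1} = a`).  This is E1's lift WITHOUT the `γ₀^{r n a}`-factor, valid exactly for the
exponents of elements of `Uₙ`. [cite: Lang1990, Ch. 10 §1 (PDF p. 167)] [cite: Washington1997, Ch. 14 (p. 321)] -/
theorem smul_eq_pow_of_cyclotomicCharacter_eq_omega' {n a : ℕ} (ha7 : a.Coprime 7) (h6 : a ^ 6 ≡ 1 [MOD 7 ^ (n + 1)])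
    {υ : absoluteGaloisGroup ℚ}
    (hυ : haveI : Fact (Nat.Prime 7) := ⟨Nat.prime_seven⟩
      GaloisRep.cyclotomicCharacter ℚ 7 υ = MulChar.toUnitHom F.ω (ZMod.unitOfCoprime a ha7))
    (ζ : AlgebraicClosure ℚ) (hζ : ζ ^ 7 ^ (n + 1) = 1) : υ • ζ = ζ ^ a := by
  haveI : Fact (Nat.Prime 7) := ⟨Nat.prime_seven⟩
  rw [GaloisRep.cyclotomicCharacter_spec ℚ 7 (k := n + 1) υ ζ hζ, hυ, MulChar.coe_toUnitHom, ZMod.coe_unitOfCoprime]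
  have hker : (PadicInt.toZModPow (n + 1)) (F.ω (a : ZMod 7)) = (PadicInt.toZModPow (n + 1)) ((a : ℕ) : ℤ_[7]) := by
    rw [eq_comm, ← RingHom.sub_mem_ker_iff, PadicInt.ker_toZModPow]
    exact F.natCast_sub_omega_mem_span_of_pow_six ha7 h6
  rw [hker, map_natCast, ZMod.val_natCast, ← pow_eq_pow_mod a hζ]

end Layer

/-! ## §4 (U*) `Uₙ ⊓ H₀ ≤ Hₙ`; the exponent of `Γ_K/H₀` divides `6`; (A2) `7 ∤ [Γ_K:H₀]`; `Uₙ ⊔ H₀ = Γ_K` -/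

section Index

variable (h2 : Module.finrank ℚ Kcm = 2) (K : ZpExtension ℚ 7)
  {c : absoluteGaloisGroup Kcm →* absoluteGaloisGroup ℚ}

/-- A power of an automorphism acting on the `N`-th roots of unity by `v` acts by `v^k`. [cite: Washington1997, Thm. 2.5] -/
theorem pow_smul_eq_pow_pow {N : ℕ} {g : absoluteGaloisGroup ℚ} {v : ℕ}
    (hg : ∀ ζ : AlgebraicClosure ℚ, ζ ^ N = 1 → g • ζ = ζ ^ v) (k : ℕ) (ζ : AlgebraicClosure ℚ) (hζ : ζ ^ N = 1) :
    (g ^ k) • ζ = ζ ^ v ^ k := by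
  induction k with
  | zero => rw [pow_zero, one_smul, pow_zero, pow_one]
  | succ k ih =>
    rw [pow_succ, mul_smul, hg ζ hζ, smul_pow', ih, ← pow_mul, ← pow_succ]

/-- **(U*) `Uₙ ⊓ H₀ ≤ Hₙ`**: an element of `Uₙ` fixing `e⁻¹F′₀` fixes `e⁻¹F′ₙ` — its exponent `a` on `μ_{7^{n+1}}(K̄)` has `a⁶ ≡ 1
(7^{n+1})` (`Uₙ`) and `a ≡ 1 (7)` (it fixes `μ₇ ⊂ e⁻¹F′₀`), so `a ≡ 1 (7^{n+1})`; with `F′ₙ = F₀ ⊔ ℚ(μ_{7^{n+1}})`.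
[cite: Washington1997, §13.1] [cite: Kato2004Asterisque, §15.5 (p. 253)] -/
theorem inf_layerFixing_zero_le (hc : ∀ (σ : absoluteGaloisGroup Kcm) (z : AlgebraicClosure Kcm), e (σ • z) = c σ • e z)
    (hbij : Function.Bijective e) (hK : K.IsCyclotomic) (n : ℕ) :
    (K.restrictOfFinrankEqTwo (by decide) Kcm h2).layerSubgroup n ⊓ layerFixing F e 0 ≤ layerFixing F e n := by
  haveI : Fact (Nat.Prime 7) := ⟨Nat.prime_seven⟩
  haveI : NeZero (7 ^ (n + 1) * F.d) := ⟨mul_ne_zero (pow_ne_zero _ (by norm_num)) F.d_ne_zero⟩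
  haveI : NeZero (7 ^ (n + 1)) := ⟨pow_ne_zero _ (by norm_num)⟩
  rintro σ ⟨hσU, hσ0⟩
  -- a primitive `7^{n+1}`-th root `ξ = ζ′ₙ^{|D|} ∈ K̄`
  obtain ⟨ζ', -, hζ'⟩ := F.exists_apply_eq_ζsys e n
  have hξ : IsPrimitiveRoot (ζ' ^ F.d) (7 ^ (n + 1)) := hζ'.pow (NeZero.pos _) (mul_comm _ _)
  obtain ⟨a, ha, hσξ⟩ := exists_smul_eq_pow_of_isPrimitiveRoot hξ σ
  have h6 := exists_modEq_pow_six_of_mem_layerSubgroup h2 K hK n hσU hξ hσξ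
  -- `σ ∈ H₀` fixes the primitive 7th root `ξ^{7ⁿ}` (its `e`-image lies in `μ₇ ⊂ F′₀`), so `a ≡ 1 (7)`
  have hξ7 : IsPrimitiveRoot ((ζ' ^ F.d) ^ 7 ^ n) 7 := hξ.pow (NeZero.pos _) (by ring)
  have hmem0 : e ((ζ' ^ F.d) ^ 7 ^ n) ∈ F.layer 0 := by
    refine mem_cyclotomicLayer_of_pow_eq_one F.F₀ 7 0 ?_
    rw [zero_add, pow_one, ← map_pow, hξ7.pow_eq_one, map_one]
  have ha1 : a ≡ 1 [MOD 7] := by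
    have hfix := F.smul_eq_of_apply_mem_layer e 0 hmem0 hσ0
    rw [smul_pow', hσξ, ← pow_mul, mul_comm, pow_mul] at hfix
    have h' : ((ζ' ^ F.d) ^ 7 ^ n) ^ a = ((ζ' ^ F.d) ^ 7 ^ n) ^ 1 := by rw [pow_one]; exact hfix
    haveI : NeZero (7 : ℕ) := ⟨by norm_num⟩
    exact modEq_of_pow_eq_pow hξ7 h'
  have ha' : a ≡ 1 [MOD 7 ^ (n + 1)] := modEq_one_of_pow_six ha1 h6
  -- hence `σ` fixes `ξ`, and `c σ` fixes every `7^{n+1}`-th root of unity of `ℚ̄`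
  have h1lt : 1 < 7 ^ (n + 1) := Nat.one_lt_pow (Nat.succ_ne_zero n) (by norm_num)
  have hσξ' : σ • (ζ' ^ F.d) = ζ' ^ F.d := by
    rw [hσξ, pow_eq_pow_mod a hξ.pow_eq_one, ha', Nat.one_mod_eq_one.mpr h1lt.ne', pow_one]
  have heξ : IsPrimitiveRoot (e (ζ' ^ F.d)) (7 ^ (n + 1)) := hξ.map_of_injective e.injective
  have hc1 : c σ • e (ζ' ^ F.d) = e (ζ' ^ F.d) ^ 1 := by rw [pow_one, ← hc, hσξ']
  have hT : ∀ x ∈ {x : AlgebraicClosure ℚ | x ^ 7 ^ (n + 1) = 1}, c σ • x = (1 : absoluteGaloisGroup ℚ) • x := by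
    intro x hx
    rw [one_smul, smul_eq_pow_of_smul_primitiveRoot heξ hc1 (dvd_refl _) x hx, pow_one]
  -- `c σ` fixes `F₀ ⊆ F′₀`
  have hc0 : c σ ∈ galFixing ℚ (F.layer 0) := (F.mem_layerFixing_iff_mem_galFixing e hc hbij 0 σ).mp hσ0
  have hS : ∀ x ∈ (F.F₀ : Set (AlgebraicClosure ℚ)), c σ • x = (1 : absoluteGaloisGroup ℚ) • x := by
    intro x hx
    rw [one_smul]
    exact (mem_galFixing_iff ℚ).mp hc0 x (le_cyclotomicLayer F.F₀ 7 0 hx)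
  -- so `c σ` fixes `F′ₙ`
  rw [F.mem_layerFixing_iff_mem_galFixing e hc hbij n σ, mem_galFixing_iff]
  intro x hx
  have h := forall_smul_eq_of_le_sup_adjoin (IntermediateField.subset_adjoin ℚ (F.F₀ : Set (AlgebraicClosure ℚ))) hS hT x
    (by rw [← cyclotomicLayer_def]; exact hx)
  rwa [one_smul] at h

/-- **`σ⁶ ∈ H₀` for every `σ ∈ Γ_K`**: `c σ` acts on `μ₇` by some `v` with `v⁶ ≡ 1 (7)` and on each `√D` by `±1`, so
`(c σ)⁶` fixes `F′₀ = ℚ(√D) ⊔ ℚ(μ₇)`. [cite: Washington1997, Thm. 2.5] [cite: Tsuji1999, §3 (p. 6, «Gal(K_n/ℚ) ≅ G × Gal(K_n/K)»)] -/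
theorem pow_six_mem_layerFixing_zero (hc : ∀ (σ : absoluteGaloisGroup Kcm) (z : AlgebraicClosure Kcm), e (σ • z) = c σ • e z)
    (hbij : Function.Bijective e) (σ : absoluteGaloisGroup Kcm) : σ ^ 6 ∈ layerFixing F e 0 := by
  haveI : Fact (Nat.Prime 7) := ⟨Nat.prime_seven⟩
  haveI : NeZero (7 : ℕ) := ⟨by norm_num⟩
  rw [F.mem_layerFixing_iff_mem_galFixing e hc hbij 0, map_pow, mem_galFixing_iff]
  -- on `μ₇`
  set v : ℕ := ((modNCyclotomicCharacter ℚ 7 (c σ) : (ZMod 7)ˣ) : ZMod 7).val with hv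
  have hμ : ∀ ζ : AlgebraicClosure ℚ, ζ ^ 7 = 1 → c σ • ζ = ζ ^ v := fun ζ hζ ↦ modNCyclotomicCharacter_spec ℚ 7 (c σ) ζ hζ
  have hv6 : v ^ 6 ≡ 1 [MOD 7] := by
    have hcop : v.Coprime 7 := ZMod.val_coe_unit_coprime _
    have := Nat.ModEq.pow_totient hcop
    rwa [Nat.totient_prime Nat.prime_seven] at this
  have hT : ∀ x ∈ {x : AlgebraicClosure ℚ | x ^ 7 ^ (0 + 1) = 1}, (c σ ^ 6) • x = (1 : absoluteGaloisGroup ℚ) • x := by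
    intro x hx
    have hx' : x ^ 7 = 1 := by simpa using hx
    rw [one_smul, pow_smul_eq_pow_pow hμ 6 x hx', pow_eq_pow_mod _ hx', hv6, ← pow_eq_pow_mod _ hx', pow_one]
  -- on the square roots of `D`
  have hS : ∀ x ∈ {x : AlgebraicClosure ℚ | x ^ 2 = (F.D : AlgebraicClosure ℚ)}, (c σ ^ 6) • x = (1 : absoluteGaloisGroup ℚ) • x := by
    intro x hx
    have hx2 : (c σ • x) ^ 2 = x ^ 2 := by
      rw [← smul_pow', (show x ^ 2 = (F.D : AlgebraicClosure ℚ) from hx), absoluteGaloisGroup.smul_def, map_intCast]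
    have h2' : (c σ ^ 2) • x = x := by
      rcases sq_eq_sq_iff_eq_or_eq_neg.mp hx2 with h | h
      · rw [pow_two, mul_smul, h, h]
      · rw [pow_two, mul_smul, h, smul_neg, h, neg_neg]
    rw [one_smul, show (6 : ℕ) = 2 * 3 by norm_num, pow_mul]
    have : ∀ k : ℕ, ((c σ ^ 2) ^ k) • x = x := by
      intro k
      induction k with
      | zero => rw [pow_zero, one_smul]
      | succ k ih => rw [pow_succ, mul_smul, h2', ih]
    exact this 3
  intro x hx
  have h := forall_smul_eq_of_le_sup_adjoin (E := F.F₀) (le_of_eq F.F₀_eq) hS hT x (by rw [← cyclotomicLayer_def]; exact hx)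
  rwa [one_smul] at h

/-- ★ **(A2) `7 ∤ [Γ_K : H₀]`**: `Γ_K/H₀` is a finite group of exponent dividing `6` (`pow_six_mem_layerFixing_zero`), so by Cauchy it
has no element of order `7`.  (At the consumer `[Uₙ : Hₙ] = [Γ_K : H₀]` through the bijection `Uₙ/Hₙ ≃ Γ_K/H₀` of (U*) and
`layerSubgroup_sup_layerFixing_zero`.) [cite: Tsuji1999, §3 (p. 6, «p ∤ #G»)] [cite: Washington1997, §13.1] -/
theorem not_seven_dvd_index_layerFixing_zero
    (hc : ∀ (σ : absoluteGaloisGroup Kcm) (z : AlgebraicClosure Kcm), e (σ • z) = c σ • e z)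
    (hbij : Function.Bijective e) [(layerFixing F e 0).FiniteIndex] : ¬ 7 ∣ (layerFixing F e 0).index := by
  haveI : Fact (Nat.Prime 7) := ⟨Nat.prime_seven⟩
  haveI := F.layerFixing_normal e 0
  intro h7
  rw [Subgroup.index] at h7
  obtain ⟨g, hg⟩ := exists_prime_orderOf_dvd_card' (G := absoluteGaloisGroup Kcm ⧸ layerFixing F e 0) 7 h7
  obtain ⟨σ, rfl⟩ := QuotientGroup.mk_surjective g
  have h1 : (QuotientGroup.mk σ : absoluteGaloisGroup Kcm ⧸ layerFixing F e 0) ^ 6 = 1 := by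
    rw [← QuotientGroup.mk_pow, QuotientGroup.eq_one_iff]
    exact F.pow_six_mem_layerFixing_zero e hc hbij σ
  have hdvd : orderOf (QuotientGroup.mk σ : absoluteGaloisGroup Kcm ⧸ layerFixing F e 0) ∣ 6 := orderOf_dvd_of_pow_eq_one h1
  rw [hg] at hdvd
  omega

/-- **`Uₙ ⊔ H₀ = Γ_K`**: the index of `Uₙ ⊔ H₀` divides `[Γ_K : Uₙ] = 7ⁿ` and `[Γ_K : H₀]`, which is prime to `7`.
[cite: Washington1997, §13.1] [cite: Tsuji1999, §3 (p. 6, «K ∩ B_∞ = ℚ»)] -/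
theorem layerSubgroup_sup_layerFixing_zero
    (hc : ∀ (σ : absoluteGaloisGroup Kcm) (z : AlgebraicClosure Kcm), e (σ • z) = c σ • e z)
    (hbij : Function.Bijective e) [(layerFixing F e 0).FiniteIndex] (n : ℕ) :
    (K.restrictOfFinrankEqTwo (by decide) Kcm h2).layerSubgroup n ⊔ layerFixing F e 0 = ⊤ := by
  haveI : Fact (Nat.Prime 7) := ⟨Nat.prime_seven⟩
  rw [← Subgroup.index_eq_one]
  have h1 : ((K.restrictOfFinrankEqTwo (by decide) Kcm h2).layerSubgroup n ⊔ layerFixing F e 0).index ∣ 7 ^ n := by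
    rw [← (K.restrictOfFinrankEqTwo (by decide) Kcm h2).index_layerSubgroup n]
    exact Subgroup.index_dvd_of_le le_sup_left
  have h2' : ((K.restrictOfFinrankEqTwo (by decide) Kcm h2).layerSubgroup n ⊔ layerFixing F e 0).index ∣
      (layerFixing F e 0).index := Subgroup.index_dvd_of_le le_sup_right
  have hcop : Nat.Coprime (7 ^ n) (layerFixing F e 0).index :=
    Nat.Coprime.pow_left n ((Nat.Prime.coprime_iff_not_dvd Nat.prime_seven).mpr
      (F.not_seven_dvd_index_layerFixing_zero e hc hbij))
  exact Nat.dvd_one.mp (hcop ▸ Nat.dvd_gcd h1 h2')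

/-- **Every `H₀`-coset meets `Uₙ`**: for every `g ∈ Γ_K` there is `u ∈ Uₙ` with `u⁻¹g ∈ H₀` (`Γ_K = Uₙ·H₀`, `H₀ ⊴ Γ_K`).
[cite: Washington1997, §13.1] -/
theorem exists_mem_layerSubgroup_inv_mul_mem
    (hc : ∀ (σ : absoluteGaloisGroup Kcm) (z : AlgebraicClosure Kcm), e (σ • z) = c σ • e z)
    (hbij : Function.Bijective e) [(layerFixing F e 0).FiniteIndex] (n : ℕ) (g : absoluteGaloisGroup Kcm) :
    ∃ u ∈ (K.restrictOfFinrankEqTwo (by decide) Kcm h2).layerSubgroup n, u⁻¹ * g ∈ layerFixing F e 0 := by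
  haveI := F.layerFixing_normal e 0
  have hg : g ∈ (((K.restrictOfFinrankEqTwo (by decide) Kcm h2).layerSubgroup n ⊔ layerFixing F e 0 :
      Subgroup (absoluteGaloisGroup Kcm)) : Set (absoluteGaloisGroup Kcm)) := by
    rw [F.layerSubgroup_sup_layerFixing_zero e h2 K hc hbij n]; exact Subgroup.mem_top g
  rw [Subgroup.mul_normal] at hg
  obtain ⟨u, hu, h, hh, rfl⟩ := Set.mem_mul.mp hg
  exact ⟨u, hu, by rwa [← mul_assoc, inv_mul_cancel, one_mul]⟩

end Index

end GenusFrame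

end Summit.BirchSwinnertonDyer.Rank1Residual.Additive.GenusSeven

end
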